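import Literature.Analysis.UnboundedOperators.LinearizedBoltzmannSymmetryProofs
import Literature.Analysis.UnboundedOperators.LinearizedBoltzmannCoercivity1D
import Literature.Probability.Distributions.GaussianRectangleForm
import Literature.Probability.Distributions.StdGaussianFibre
import HarnessLib

/-!
# Fibre reduction of the hard-sphere Dirichlet form to the rectangle form

Let `E` be a finite-dimensional real inner product space, `γ = stdGaussian E`, `γ₁ = gaussianReal 0 1`,
`σ` the surface measure of the unit sphere and `L` the linearised hard-sphere operator
(`LinearizedBoltzmann.hardSphereLinearizedOp`). By the symmetrised weak form
(`LinearizedBoltzmannSymmetryProofs`),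
`-⟨g, Lg⟩_M = ¼ ∫∫∫ M M_* ((v-v_*)·ω)_+ (g' + g_*' - g - g_*)² dω dv dv_*`.
For a fixed direction `ω` we pass to fibre coordinates `v = cω + P_ω z`, `v_* = sω + P_ω z_*`
(`StdGaussianFibre`; `P_ω z = z - ⟪z,ω⟫ω`): then `((v-v_*)·ω)_+ = (c-s)_+`, the post-collisional
velocities are `sω + P_ω z`, `cω + P_ω z_*` (the collision exchanges the `ω`-coordinates), and
`g' + g_*' - g - g_* = -R_ω g((c,s),(z,z_*))` is minus the rectangle increment of
`GaussianRectangleForm`. Symmetrising in `c ↔ s` and applying the Gaussian hard-rod coercivity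
(`LinearizedBoltzmannCoercivity1D.lintegral_sq_sub_le_hardRod_gaussianReal`) on each fibre gives

* `lintegral_rectIncr_sq_le` : `∫ (R_ω g)² d((γ₁⊗γ₁)⊗(γ⊗γ)) ≤ 2C₁ ∫∫ ((v-v_*)·ω)_+ (Δg)² dγ dγ_*`,
* `lintegral_sphere_rectIncr_sq_le` : integrated over `ω`, with the right side expressed through
  the Lebesgue-measure form of the symmetrised identity,
* `rectForm_toReal_le_neg_maxwellianInner` :
  `(∫_S ∫ (R_ω g)²).toReal ≤ 8 C₁ · (-⟨g, Lg⟩_M)` for `g` of temperate growth.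

Here `C₁ = 1 + 4 / min(γ₁[2,∞), γ₁(-∞,-2])` is the hard-rod constant. This is the "Step B/C" of the
spectral-gap proof for `L` (fibre decomposition à la Baranger–Mouhot 2005, Lemma 2.2, in Gaussian form).
-/

open MeasureTheory Metric Real Set ProbabilityTheory Module
open scoped InnerProductSpace ENNReal

namespace Literature.Analysis.UnboundedOperators

noncomputable section

open Literature.MathematicalPhysics.KineticTheory (sphereMeasure collide hardSphereKernel)
open Literature.Analysis.FluidPDE
open Literature.Probability.Distributions

variable {E : Type*} [NormedAddCommGroup E] [InnerProductSpace ℝ E]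

/-! ### Fibre coordinates and the collision -/

/-- `⟪z - ⟪z,ω⟫ω, ω⟫ = 0` for a unit vector `ω`. [folklore] -/
theorem inner_proj_unit {ω : E} (hω : ‖ω‖ = 1) (z : E) : ⟪z - ⟪z, ω⟫_ℝ • ω, ω⟫_ℝ = 0 := by
  have hωω : ⟪ω, ω⟫_ℝ = 1 := by rw [real_inner_self_eq_norm_sq, hω, one_pow]
  rw [inner_sub_left, inner_smul_left, hωω, RCLike.conj_to_real, mul_one, sub_self]

/-- The `ω`-component of the relative velocity in fibre coordinates is `c - s`. [folklore] -/
theorem inner_fibre_sub_fibre {ω : E} (hω : ‖ω‖ = 1) (c s : ℝ) (z z' : E) :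
    ⟪c • ω + (z - ⟪z, ω⟫_ℝ • ω) - (s • ω + (z' - ⟪z', ω⟫_ℝ • ω)), ω⟫_ℝ = c - s := by
  have hωω : ⟪ω, ω⟫_ℝ = 1 := by rw [real_inner_self_eq_norm_sq, hω, one_pow]
  have h1 := inner_proj_unit hω z
  have h2 := inner_proj_unit hω z'
  rw [inner_sub_left, inner_add_left, inner_add_left, inner_smul_left, inner_smul_left, h1, h2, hωω]
  simp

/-- **The collision in fibre coordinates exchanges the `ω`-coordinates**:
`collide ω (cω + Pz, sω + Pz_*) = (sω + Pz, cω + Pz_*)`. [folklore] -/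
theorem collide_fibre (ω : sphere (0 : E) 1) (c s : ℝ) (z z' : E) :
    collide ω (c • (ω : E) + (z - ⟪z, (ω : E)⟫_ℝ • (ω : E)), s • (ω : E) + (z' - ⟪z', (ω : E)⟫_ℝ • (ω : E))) =
      (s • (ω : E) + (z - ⟪z, (ω : E)⟫_ℝ • (ω : E)), c • (ω : E) + (z' - ⟪z', (ω : E)⟫_ℝ • (ω : E))) := by
  have hω : ‖(ω : E)‖ = 1 := norm_eq_of_mem_sphere ω
  simp only [collide, inner_fibre_sub_fibre hω]
  refine Prod.ext ?_ ?_
  · simp only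
    rw [sub_smul]; abel
  · simp only
    rw [sub_smul]; abel

/-- The hard-sphere kernel in fibre coordinates is the hard-rod kernel `(c - s)_+`. [folklore] -/
theorem hardSphereKernel_fibre (ω : sphere (0 : E) 1) (c s : ℝ) (z z' : E) :
    hardSphereKernel (c • (ω : E) + (z - ⟪z, (ω : E)⟫_ℝ • (ω : E)), s • (ω : E) + (z' - ⟪z', (ω : E)⟫_ℝ • (ω : E))) ω =
      max (c - s) 0 := by
  have hω : ‖(ω : E)‖ = 1 := norm_eq_of_mem_sphere ω
  simp only [hardSphereKernel, inner_fibre_sub_fibre hω]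

/-- The collision integrand `B (Δg)²` in fibre coordinates: `(c-s)_+ · (R_ω g)²`. [folklore] -/
theorem kernel_mul_collisionDiff_sq_fibre (ω : sphere (0 : E) 1) (g : E → ℝ) (c s : ℝ) (z z' : E) :
    hardSphereKernel (c • (ω : E) + (z - ⟪z, (ω : E)⟫_ℝ • (ω : E)),
        s • (ω : E) + (z' - ⟪z', (ω : E)⟫_ℝ • (ω : E))) ω *
      (g (collide ω (c • (ω : E) + (z - ⟪z, (ω : E)⟫_ℝ • (ω : E)),
          s • (ω : E) + (z' - ⟪z', (ω : E)⟫_ℝ • (ω : E)))).1 +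
        g (collide ω (c • (ω : E) + (z - ⟪z, (ω : E)⟫_ℝ • (ω : E)),
          s • (ω : E) + (z' - ⟪z', (ω : E)⟫_ℝ • (ω : E)))).2 -
        g (c • (ω : E) + (z - ⟪z, (ω : E)⟫_ℝ • (ω : E))) -
        g (s • (ω : E) + (z' - ⟪z', (ω : E)⟫_ℝ • (ω : E)))) ^ 2 =
      max (c - s) 0 * rectIncr (ω : E) g ((c, s), (z, z')) ^ 2 := by
  rw [collide_fibre, hardSphereKernel_fibre]
  simp only [rectIncr]
  ring

/-! ### One-dimensional symmetrisation -/

/-- **Symmetrisation**: for a symmetric nonnegative weight `f(c,s) = f(s,c)`,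
`∫∫ |c-s| f dγ₁ dγ₁ = 2 ∫∫ (c-s)_+ f dγ₁ dγ₁`. [folklore] -/
theorem lintegral_abs_sub_mul_eq_two_mul {f : ℝ → ℝ → ℝ} (hf : Measurable (Function.uncurry f))
    (h0 : ∀ c s, 0 ≤ f c s) (hsymm : ∀ c s, f c s = f s c) (μ : Measure ℝ) [SFinite μ] :
    ∫⁻ c, ∫⁻ s, ENNReal.ofReal (|c - s| * f c s) ∂μ ∂μ =
      2 * ∫⁻ c, ∫⁻ s, ENNReal.ofReal (max (c - s) 0 * f c s) ∂μ ∂μ := by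
  have hsplit : ∀ c s, ENNReal.ofReal (|c - s| * f c s) =
      ENNReal.ofReal (max (c - s) 0 * f c s) + ENNReal.ofReal (max (s - c) 0 * f c s) := by
    intro c s
    rw [← ENNReal.ofReal_add (mul_nonneg (le_max_right _ _) (h0 c s))
      (mul_nonneg (le_max_right _ _) (h0 c s)), ← add_mul, ← neg_sub c s,
      max_zero_add_max_neg_zero_eq_abs_self]
  simp_rw [hsplit]
  have hm1 : Measurable fun p : ℝ × ℝ => ENNReal.ofReal (max (p.1 - p.2) 0 * f p.1 p.2) :=
    ((by fun_prop : Measurable fun p : ℝ × ℝ => max (p.1 - p.2) 0).mul hf).ennreal_ofReal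
  have hm2 : Measurable fun p : ℝ × ℝ => ENNReal.ofReal (max (p.2 - p.1) 0 * f p.1 p.2) :=
    ((by fun_prop : Measurable fun p : ℝ × ℝ => max (p.2 - p.1) 0).mul hf).ennreal_ofReal
  have hinner : ∀ c, ∫⁻ s, ENNReal.ofReal (max (c - s) 0 * f c s) + ENNReal.ofReal (max (s - c) 0 * f c s) ∂μ =
      ∫⁻ s, ENNReal.ofReal (max (c - s) 0 * f c s) ∂μ + ∫⁻ s, ENNReal.ofReal (max (s - c) 0 * f c s) ∂μ :=
    fun c => lintegral_add_left (hm1.comp measurable_prodMk_left) _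
  simp_rw [hinner]
  rw [lintegral_add_left hm1.lintegral_prod_right', two_mul]
  congr 1
  -- swap the variables in the second integral
  rw [lintegral_lintegral_swap (hm2.aemeasurable)]
  refine lintegral_congr fun s => lintegral_congr fun c => ?_
  rw [hsymm c s]

/-! ### The fibre reduction for a fixed direction -/

section Fibre

variable [FiniteDimensional ℝ E] [MeasurableSpace E] [BorelSpace E]

/-- Fubini along a unit vector with the fibre coordinate *inside*:
`∫ F dγ = ∫ (∫ F(cω + P_ω z) dγ₁(c)) dγ(z)`. [folklore] -/
theorem lintegral_stdGaussian_fibre_symm {ω : E} (hω : ‖ω‖ = 1) {F : E → ℝ≥0∞} (hF : Measurable F) :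
    ∫⁻ x, F x ∂stdGaussian E =
      ∫⁻ z, ∫⁻ c, F (c • ω + (z - ⟪z, ω⟫_ℝ • ω)) ∂gaussianReal 0 1 ∂stdGaussian E := by
  rw [lintegral_stdGaussian_fibre hω hF]
  exact lintegral_lintegral_swap ((hF.comp (continuous_fibreMap ω).measurable).aemeasurable)

/-- **Two-particle fibre coordinates**: for measurable `F ≥ 0` on `E × E` and a unit vector `ω`,
`∫∫ F(v, v_*) dγ dγ_* = ∫∫∫∫ F(cω + P_ω z, sω + P_ω z_*) dγ₁(s) dγ₁(c) dγ(z_*) dγ(z)`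
(order of integration: `z, z_*, c, s` from the outside). [folklore] -/
theorem lintegral_lintegral_stdGaussian_fibre₂ {ω : E} (hω : ‖ω‖ = 1) {F : E × E → ℝ≥0∞}
    (hF : Measurable F) :
    ∫⁻ v, ∫⁻ w, F (v, w) ∂stdGaussian E ∂stdGaussian E =
      ∫⁻ z, ∫⁻ z', ∫⁻ c, ∫⁻ s,
        F (c • ω + (z - ⟪z, ω⟫_ℝ • ω), s • ω + (z' - ⟪z', ω⟫_ℝ • ω))
        ∂gaussianReal 0 1 ∂gaussianReal 0 1 ∂stdGaussian E ∂stdGaussian E := by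
  -- outer fibre (coordinate inside)
  rw [lintegral_stdGaussian_fibre_symm hω hF.lintegral_prod_right']
  refine lintegral_congr fun z => ?_
  -- inner fibre, for each `c`
  have hin : ∀ c : ℝ, ∫⁻ w, F (c • ω + (z - ⟪z, ω⟫_ℝ • ω), w) ∂stdGaussian E =
      ∫⁻ z', ∫⁻ s, F (c • ω + (z - ⟪z, ω⟫_ℝ • ω), s • ω + (z' - ⟪z', ω⟫_ℝ • ω))
        ∂gaussianReal 0 1 ∂stdGaussian E := fun c =>
    lintegral_stdGaussian_fibre_symm hω
      (hF.comp (measurable_prodMk_left (x := c • ω + (z - ⟪z, ω⟫_ℝ • ω))))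
  simp_rw [hin]
  -- swap `c` and `z'`
  have hm : Measurable fun q : (ℝ × E) × ℝ =>
      F (q.1.1 • ω + (z - ⟪z, ω⟫_ℝ • ω), q.2 • ω + (q.1.2 - ⟪q.1.2, ω⟫_ℝ • ω)) :=
    hF.comp (Continuous.measurable (by fun_prop))
  exact lintegral_lintegral_swap hm.lintegral_prod_right'.aemeasurable

/-- The four-variable rectangle measure splits as iterated integrals in the order `z, z_*, c, s`. [folklore] -/
theorem lintegral_rectMeasure_eq {G : (ℝ × ℝ) × (E × E) → ℝ≥0∞} (hG : Measurable G) :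
    ∫⁻ q, G q ∂(((gaussianReal 0 1).prod (gaussianReal 0 1)).prod ((stdGaussian E).prod (stdGaussian E))) =
      ∫⁻ z, ∫⁻ z', ∫⁻ c, ∫⁻ s, G ((c, s), (z, z'))
        ∂gaussianReal 0 1 ∂gaussianReal 0 1 ∂stdGaussian E ∂stdGaussian E := by
  rw [lintegral_prod_symm _ hG.aemeasurable]
  have hm : Measurable fun q : (E × E) × (ℝ × ℝ) => G (q.2, q.1) := hG.comp measurable_swap
  rw [lintegral_prod _ hm.lintegral_prod_right'.aemeasurable]
  refine lintegral_congr fun z => lintegral_congr fun z' => ?_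
  exact lintegral_prod _ ((hG.comp (Continuous.measurable (by fun_prop))).aemeasurable)

/-- **The hard-rod step on one fibre**: for measurable `a`,
`∫∫ (a c - a s)² dγ₁ dγ₁ ≤ 2 C₁ ∫∫ (c-s)_+ (a c - a s)² dγ₁ dγ₁`. [folklore] -/
theorem lintegral_sq_sub_le_two_mul_hardRod_pos {a : ℝ → ℝ} (ha : Measurable a) :
    ∫⁻ c, ∫⁻ s, ENNReal.ofReal ((a c - a s) ^ 2) ∂gaussianReal 0 1 ∂gaussianReal 0 1 ≤
      2 * (1 + 4 * (min (gaussianReal 0 1 (Set.Ici 2)) (gaussianReal 0 1 (Set.Iic (-2))))⁻¹) *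
        ∫⁻ c, ∫⁻ s, ENNReal.ofReal (max (c - s) 0 * (a c - a s) ^ 2) ∂gaussianReal 0 1 ∂gaussianReal 0 1 := by
  refine (lintegral_sq_sub_le_hardRod_gaussianReal ha).trans (le_of_eq ?_)
  have hf2 : Measurable (Function.uncurry fun c s => (a c - a s) ^ 2) := by
    simp only [Function.uncurry_def]; fun_prop
  rw [lintegral_abs_sub_mul_eq_two_mul hf2 (fun c s => sq_nonneg _) (fun c s => by ring)]
  ring

/-- **The fibre reduction** (fixed direction `ω`, continuous `g`): the Maxwellian-weighted hard-sphere
form dominates the rectangle form,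
`∫ (R_ω g)² d((γ₁⊗γ₁)⊗(γ⊗γ)) ≤ 2 C₁ ∫∫ ((v-v_*)·ω)_+ (Δ_ω g)² dγ(v_*) dγ(v)`. [folklore] -/
theorem lintegral_rectIncr_sq_le (ω : sphere (0 : E) 1) {g : E → ℝ} (hg : Continuous g) :
    ∫⁻ q, ENNReal.ofReal (rectIncr (ω : E) g q ^ 2)
        ∂(((gaussianReal 0 1).prod (gaussianReal 0 1)).prod ((stdGaussian E).prod (stdGaussian E))) ≤
      2 * (1 + 4 * (min (gaussianReal 0 1 (Set.Ici 2)) (gaussianReal 0 1 (Set.Iic (-2))))⁻¹) *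
        ∫⁻ v, ∫⁻ w, ENNReal.ofReal (hardSphereKernel (v, w) ω *
          (g (collide ω (v, w)).1 + g (collide ω (v, w)).2 - g v - g w) ^ 2)
          ∂stdGaussian E ∂stdGaussian E := by
  have hω : ‖(ω : E)‖ = 1 := norm_eq_of_mem_sphere ω
  set C : ℝ≥0∞ := 2 * (1 + 4 * (min (gaussianReal 0 1 (Set.Ici 2)) (gaussianReal 0 1 (Set.Iic (-2))))⁻¹)
    with hC
  have hCtop : C ≠ ⊤ := ENNReal.mul_ne_top (by norm_num) hardRod_gaussianReal_const_ne_top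
  -- measurability of the two integrands
  have hcoll : Continuous fun p : E × E => collide ω p := by unfold collide; fun_prop
  have hFc : Continuous fun p : E × E => hardSphereKernel p ω *
      (g (collide ω p).1 + g (collide ω p).2 - g p.1 - g p.2) ^ 2 := by
    refine Continuous.mul (by unfold hardSphereKernel; fun_prop) (Continuous.pow ?_ 2)
    exact (((hg.comp (continuous_fst.comp hcoll)).add (hg.comp (continuous_snd.comp hcoll))).sub
      (hg.comp continuous_fst)).sub (hg.comp continuous_snd)
  have hFm : Measurable fun p : E × E => ENNReal.ofReal (hardSphereKernel p ω *
      (g (collide ω p).1 + g (collide ω p).2 - g p.1 - g p.2) ^ 2) := hFc.measurable.ennreal_ofReal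
  have hRc : Continuous fun q : (ℝ × ℝ) × (E × E) => rectIncr (ω : E) g q := by
    unfold rectIncr; fun_prop
  have hRm : Measurable fun q : (ℝ × ℝ) × (E × E) => ENNReal.ofReal (rectIncr (ω : E) g q ^ 2) :=
    (hRc.pow 2).measurable.ennreal_ofReal
  rw [lintegral_rectMeasure_eq hRm, lintegral_lintegral_stdGaussian_fibre₂ hω hFm,
    ← lintegral_const_mul' _ _ hCtop]
  refine lintegral_mono fun z => ?_
  rw [← lintegral_const_mul' _ _ hCtop]
  refine lintegral_mono fun z' => ?_
  -- on the fibre `(z, z')`: `R = a c - a s` with `a c = g(cω+Pz) - g(cω+Pz')`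
  set a : ℝ → ℝ := fun c => g (c • (ω : E) + (z - ⟪z, (ω : E)⟫_ℝ • (ω : E))) -
    g (c • (ω : E) + (z' - ⟪z', (ω : E)⟫_ℝ • (ω : E))) with ha
  have ham : Measurable a := by rw [ha]; exact Continuous.measurable (by fun_prop)
  have hR : ∀ c s, rectIncr (ω : E) g ((c, s), (z, z')) = a c - a s := by
    intro c s; simp only [rectIncr, ha]; ring
  simp_rw [kernel_mul_collisionDiff_sq_fibre, hR]
  exact lintegral_sq_sub_le_two_mul_hardRod_pos ham

end Fibre

/-! ### Integration over the direction and the link with `⟪g, Lg⟫` -/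

section Global

variable [FiniteDimensional ℝ E] [MeasurableSpace E] [BorelSpace E]

/-- The Maxwellian two-particle measure is `γ ⊗ γ`: for measurable `G ≥ 0`,
`∫ M(v) M(v_*) G d(v, v_*) = ∫∫ G dγ dγ_*`. [folklore] -/
theorem lintegral_maxwellian_prod {G : E × E → ℝ≥0∞} (hG : Measurable G) :
    ∫⁻ p, ENNReal.ofReal (globalMaxwellian p.1) * ENNReal.ofReal (globalMaxwellian p.2) * G p
        ∂((volume : Measure E).prod volume) =
      ∫⁻ v, ∫⁻ w, G (v, w) ∂stdGaussian E ∂stdGaussian E := by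
  have hM : Measurable fun v : E => ENNReal.ofReal (globalMaxwellian v) :=
    continuous_globalMaxwellian.measurable.ennreal_ofReal
  rw [← lintegral_prod _ hG.aemeasurable, stdGaussian_eq_withDensity_globalMaxwellian_holds,
    prod_withDensity hM hM, lintegral_withDensity_eq_lintegral_mul _ (by fun_prop) hG]
  rfl

/-- **The rectangle form is dominated by the hard-sphere Dirichlet form** (`lintegral` version):
`∫_S ∫ (R_ω g)² dσ ≤ 2C₁ ∫_{E×E×S} M M_* B (Δg)²`. [folklore] -/
theorem lintegral_sphere_rectIncr_sq_le {g : E → ℝ} (hg : Continuous g) :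
    ∫⁻ ω, ∫⁻ q, ENNReal.ofReal (rectIncr (ω : E) g q ^ 2)
        ∂(((gaussianReal 0 1).prod (gaussianReal 0 1)).prod ((stdGaussian E).prod (stdGaussian E)))
        ∂(sphereMeasure : Measure (sphere (0 : E) 1)) ≤
      2 * (1 + 4 * (min (gaussianReal 0 1 (Set.Ici 2)) (gaussianReal 0 1 (Set.Iic (-2))))⁻¹) *
        ∫⁻ q : (E × E) × sphere (0 : E) 1, ENNReal.ofReal
          (globalMaxwellian q.1.1 * globalMaxwellian q.1.2 * hardSphereKernel q.1 q.2 *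
            (g (collide q.2 q.1).1 + g (collide q.2 q.1).2 - g q.1.1 - g q.1.2) ^ 2)
          ∂(((volume : Measure E).prod volume).prod sphereMeasure) := by
  haveI := isFiniteMeasure_sphereMeasure (E := E)
  set C : ℝ≥0∞ := 2 * (1 + 4 * (min (gaussianReal 0 1 (Set.Ici 2)) (gaussianReal 0 1 (Set.Iic (-2))))⁻¹)
  -- the three-variable integrand
  set H : (E × E) × sphere (0 : E) 1 → ℝ≥0∞ := fun q => ENNReal.ofReal (hardSphereKernel q.1 q.2 *
    (g (collide q.2 q.1).1 + g (collide q.2 q.1).2 - g q.1.1 - g q.1.2) ^ 2) with hH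
  have hcoll : Continuous fun q : (E × E) × sphere (0 : E) 1 => collide q.2 q.1 := by
    unfold collide; fun_prop
  have hHc : Continuous fun q : (E × E) × sphere (0 : E) 1 => hardSphereKernel q.1 q.2 *
      (g (collide q.2 q.1).1 + g (collide q.2 q.1).2 - g q.1.1 - g q.1.2) ^ 2 := by
    refine Continuous.mul (by unfold hardSphereKernel; fun_prop) (Continuous.pow ?_ 2)
    exact (((hg.comp (continuous_fst.comp hcoll)).add (hg.comp (continuous_snd.comp hcoll))).sub
      (hg.comp (continuous_fst.comp continuous_fst))).sub (hg.comp (continuous_snd.comp continuous_fst))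
  have hHm : Measurable H := hHc.measurable.ennreal_ofReal
  have hsplit : ∀ q : (E × E) × sphere (0 : E) 1, ENNReal.ofReal
      (globalMaxwellian q.1.1 * globalMaxwellian q.1.2 * hardSphereKernel q.1 q.2 *
        (g (collide q.2 q.1).1 + g (collide q.2 q.1).2 - g q.1.1 - g q.1.2) ^ 2) =
      ENNReal.ofReal (globalMaxwellian q.1.1) * ENNReal.ofReal (globalMaxwellian q.1.2) * H q := by
    intro q
    rw [hH, mul_assoc (globalMaxwellian q.1.1 * globalMaxwellian q.1.2),
      ENNReal.ofReal_mul (mul_nonneg (globalMaxwellian_pos _).le (globalMaxwellian_pos _).le),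
      ENNReal.ofReal_mul (globalMaxwellian_pos _).le]
  simp_rw [hsplit]
  have hM : Measurable fun v : E => ENNReal.ofReal (globalMaxwellian v) :=
    continuous_globalMaxwellian.measurable.ennreal_ofReal
  have hm3 : Measurable fun q : (E × E) × sphere (0 : E) 1 =>
      ENNReal.ofReal (globalMaxwellian q.1.1) * ENNReal.ofReal (globalMaxwellian q.1.2) * H q :=
    ((hM.comp (measurable_fst.comp measurable_fst)).mul (hM.comp (measurable_snd.comp measurable_fst))).mul hHm
  rw [lintegral_prod_symm _ hm3.aemeasurable]
  have hω : ∀ ω : sphere (0 : E) 1,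
      ∫⁻ p, ENNReal.ofReal (globalMaxwellian p.1) * ENNReal.ofReal (globalMaxwellian p.2) * H (p, ω)
        ∂((volume : Measure E).prod volume) =
      ∫⁻ v, ∫⁻ w, H ((v, w), ω) ∂stdGaussian E ∂stdGaussian E := fun ω =>
    lintegral_maxwellian_prod (hHm.comp measurable_prodMk_right)
  simp_rw [hω]
  rw [← lintegral_const_mul' _ _ (ENNReal.mul_ne_top (by norm_num) hardRod_gaussianReal_const_ne_top)]
  exact lintegral_mono fun ω => lintegral_rectIncr_sq_le ω hg

/-- **`-⟪g, Lg⟩_M` as a `lintegral`**: for `g` of temperate growth,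
`-⟪g, Lg⟩_M = ¼ (∫_{E×E×S} M M_* B (Δg)²).toReal`. [cite: CIPDiluteGases1994, §7.1 (7.1.10)] -/
theorem neg_maxwellianInner_hardSphereLinearizedOp_eq_toReal {g : E → ℝ} (hg : g.HasTemperateGrowth) :
    -maxwellianInner g (hardSphereLinearizedOp g) =
      4⁻¹ * (∫⁻ q : (E × E) × sphere (0 : E) 1, ENNReal.ofReal
          (globalMaxwellian q.1.1 * globalMaxwellian q.1.2 * hardSphereKernel q.1 q.2 *
            (g (collide q.2 q.1).1 + g (collide q.2 q.1).2 - g q.1.1 - g q.1.2) ^ 2)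
          ∂(((volume : Measure E).prod volume).prod sphereMeasure)).toReal := by
  haveI := isFiniteMeasure_sphereMeasure (E := E)
  have hB := isGradCutoffKernel_hardSphereKernel (E := E)
  obtain ⟨C, hC⟩ := hB.exists_bound
  have hBle : ∀ (p : E × E) (ω : sphere (0 : E) 1), |hardSphereKernel p ω| ≤ 2 * |C| * (1 + ‖p‖) ^ 1 := by
    intro p ω
    have h1 : ‖p.1 - p.2‖ ≤ ‖p‖ + ‖p‖ :=
      (norm_sub_le _ _).trans (add_le_add (norm_fst_le p) (norm_snd_le p))
    rw [abs_of_nonneg (hB.nonneg p ω), pow_one]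
    nlinarith [hC p ω, le_abs_self C, abs_nonneg C, norm_nonneg (p.1 - p.2), norm_nonneg p]
  rw [hardSphereLinearizedOp, maxwellianInner_linearizedCollisionOp_eq hB.measurable ⟨1, 2 * |C|, hBle⟩
    (fun ω p => hB.collide_neg p ω) (fun ω p => hB.swap_neg p ω) hg hg, neg_mul, neg_neg]
  congr 1
  -- integrability and nonnegativity of the integrand
  obtain ⟨a, C_g, hCg, hga⟩ := exists_abs_le_of_hasTemperateGrowth hg
  have hgc : Continuous g := hg.1.continuous
  have hcoll : Continuous fun q : (E × E) × sphere (0 : E) 1 => collide q.2 q.1 := by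
    unfold collide; fun_prop
  set D : (E × E) × sphere (0 : E) 1 → ℝ := fun q =>
    g (collide q.2 q.1).1 + g (collide q.2 q.1).2 - g q.1.1 - g q.1.2 with hD
  have hDc : Continuous D :=
    (((hgc.comp (continuous_fst.comp hcoll)).add (hgc.comp (continuous_snd.comp hcoll))).sub
      (hgc.comp (continuous_fst.comp continuous_fst))).sub (hgc.comp (continuous_snd.comp continuous_fst))
  have hDle : ∀ q : (E × E) × sphere (0 : E) 1, |D q| ≤ 4 * C_g * ((1 + ‖q.1.1‖) * (1 + ‖q.1.2‖)) ^ a := by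
    intro q
    have h := abs_collisionDiff_mul_le (h := fun _ : E => (1 : ℝ)) (b := 0) hCg zero_le_one hga
      (fun u => by simp) q.1 q.2 (one_add_norm_fst_le q.1)
    simpa [hD] using h
  have hW : ∀ q : (E × E) × sphere (0 : E) 1, |D q * D q| ≤
      (4 * C_g) ^ 2 * ((1 + ‖q.1.1‖) * (1 + ‖q.1.2‖)) ^ (a + a) := by
    intro q
    rw [abs_mul, pow_add, sq]
    have h := hDle q
    have h0 : 0 ≤ |D q| := abs_nonneg _
    calc |D q| * |D q| ≤ (4 * C_g * ((1 + ‖q.1.1‖) * (1 + ‖q.1.2‖)) ^ a) *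
        (4 * C_g * ((1 + ‖q.1.1‖) * (1 + ‖q.1.2‖)) ^ a) := mul_le_mul h h h0 (h0.trans h)
      _ = _ := by ring
  have hint := integrable_maxwellian_kernel_mul hB.measurable hBle (hDc.mul hDc).aestronglyMeasurable hW
  have hnn : ∀ q : (E × E) × sphere (0 : E) 1, 0 ≤ globalMaxwellian q.1.1 * globalMaxwellian q.1.2 *
      hardSphereKernel q.1 q.2 * (D q * D q) := fun q =>
    mul_nonneg (mul_nonneg (mul_nonneg (globalMaxwellian_pos _).le (globalMaxwellian_pos _).le)
      (hB.nonneg _ _)) (mul_self_nonneg _)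
  rw [integral_eq_lintegral_of_nonneg_ae (ae_of_all _ hnn) hint.aestronglyMeasurable]
  congr 1
  refine lintegral_congr fun q => ?_
  rw [hD, sq]

/-- **Step B of the spectral-gap proof**: for `g` of temperate growth, the sphere-averaged rectangle
form is finite and bounded by the Dirichlet form:
`(∫_S ∫ (R_ω g)² dσ).toReal ≤ 8 C₁ (-⟪g, Lg⟩_M)` with `C₁` the (finite) Gaussian hard-rod constant. [folklore] -/
theorem rectForm_toReal_le_neg_maxwellianInner {g : E → ℝ} (hg : g.HasTemperateGrowth) :
    (∫⁻ ω, ∫⁻ q, ENNReal.ofReal (rectIncr (ω : E) g q ^ 2)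
        ∂(((gaussianReal 0 1).prod (gaussianReal 0 1)).prod ((stdGaussian E).prod (stdGaussian E)))
        ∂(sphereMeasure : Measure (sphere (0 : E) 1))).toReal ≤
      8 * (1 + 4 * (min (gaussianReal 0 1 (Set.Ici 2)) (gaussianReal 0 1 (Set.Iic (-2))))⁻¹).toReal *
        (-maxwellianInner g (hardSphereLinearizedOp g)) ∧
    ∫⁻ ω, ∫⁻ q, ENNReal.ofReal (rectIncr (ω : E) g q ^ 2)
        ∂(((gaussianReal 0 1).prod (gaussianReal 0 1)).prod ((stdGaussian E).prod (stdGaussian E)))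
        ∂(sphereMeasure : Measure (sphere (0 : E) 1)) ≠ ⊤ := by
  have h1 := lintegral_sphere_rectIncr_sq_le (E := E) hg.1.continuous
  have h2 := neg_maxwellianInner_hardSphereLinearizedOp_eq_toReal hg
  set X := ∫⁻ q : (E × E) × sphere (0 : E) 1, ENNReal.ofReal
    (globalMaxwellian q.1.1 * globalMaxwellian q.1.2 * hardSphereKernel q.1 q.2 *
      (g (collide q.2 q.1).1 + g (collide q.2 q.1).2 - g q.1.1 - g q.1.2) ^ 2)
    ∂(((volume : Measure E).prod volume).prod sphereMeasure) with hX
  set C₁ : ℝ≥0∞ := 1 + 4 * (min (gaussianReal 0 1 (Set.Ici 2)) (gaussianReal 0 1 (Set.Iic (-2))))⁻¹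
  -- `X` is finite: it is the `lintegral` of an integrable function (computed in the previous proof)
  have hXfin : X ≠ ⊤ := by
    -- `-⟪g,Lg⟩ = ¼ X.toReal` and `-⟪g,Lg⟩ ≥ 0` do not give finiteness; use integrability directly
    haveI := isFiniteMeasure_sphereMeasure (E := E)
    have hB := isGradCutoffKernel_hardSphereKernel (E := E)
    obtain ⟨C, hC⟩ := hB.exists_bound
    have hBle : ∀ (p : E × E) (ω : sphere (0 : E) 1), |hardSphereKernel p ω| ≤ 2 * |C| * (1 + ‖p‖) ^ 1 := by
      intro p ω
      have h1 : ‖p.1 - p.2‖ ≤ ‖p‖ + ‖p‖ :=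
        (norm_sub_le _ _).trans (add_le_add (norm_fst_le p) (norm_snd_le p))
      rw [abs_of_nonneg (hB.nonneg p ω), pow_one]
      nlinarith [hC p ω, le_abs_self C, abs_nonneg C, norm_nonneg (p.1 - p.2), norm_nonneg p]
    obtain ⟨a, C_g, hCg, hga⟩ := exists_abs_le_of_hasTemperateGrowth hg
    have hgc : Continuous g := hg.1.continuous
    have hcoll : Continuous fun q : (E × E) × sphere (0 : E) 1 => collide q.2 q.1 := by
      unfold collide; fun_prop
    set D : (E × E) × sphere (0 : E) 1 → ℝ := fun q =>
      g (collide q.2 q.1).1 + g (collide q.2 q.1).2 - g q.1.1 - g q.1.2 with hD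
    have hDc : Continuous D :=
      (((hgc.comp (continuous_fst.comp hcoll)).add (hgc.comp (continuous_snd.comp hcoll))).sub
        (hgc.comp (continuous_fst.comp continuous_fst))).sub (hgc.comp (continuous_snd.comp continuous_fst))
    have hDle : ∀ q : (E × E) × sphere (0 : E) 1, |D q| ≤ 4 * C_g * ((1 + ‖q.1.1‖) * (1 + ‖q.1.2‖)) ^ a := by
      intro q
      have h := abs_collisionDiff_mul_le (h := fun _ : E => (1 : ℝ)) (b := 0) hCg zero_le_one hga
        (fun u => by simp) q.1 q.2 (one_add_norm_fst_le q.1)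
      simpa [hD] using h
    have hW : ∀ q : (E × E) × sphere (0 : E) 1, |D q * D q| ≤
        (4 * C_g) ^ 2 * ((1 + ‖q.1.1‖) * (1 + ‖q.1.2‖)) ^ (a + a) := by
      intro q
      rw [abs_mul, pow_add, sq]
      have h := hDle q
      have h0 : 0 ≤ |D q| := abs_nonneg _
      calc |D q| * |D q| ≤ (4 * C_g * ((1 + ‖q.1.1‖) * (1 + ‖q.1.2‖)) ^ a) *
          (4 * C_g * ((1 + ‖q.1.1‖) * (1 + ‖q.1.2‖)) ^ a) := mul_le_mul h h h0 (h0.trans h)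
        _ = _ := by ring
    have hint := integrable_maxwellian_kernel_mul hB.measurable hBle (hDc.mul hDc).aestronglyMeasurable hW
    have := hint.2
    rw [hasFiniteIntegral_iff_norm] at this
    refine ne_top_of_le_ne_top this.ne (lintegral_mono fun q => ?_)
    refine ENNReal.ofReal_le_ofReal ?_
    rw [Real.norm_eq_abs, hD, sq]
    exact le_abs_self _
  have hC₁ : C₁ ≠ ⊤ := hardRod_gaussianReal_const_ne_top
  constructor
  · have h3 := ENNReal.toReal_mono (ENNReal.mul_ne_top (ENNReal.mul_ne_top (by norm_num) hC₁) hXfin) h1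
    rw [ENNReal.toReal_mul, ENNReal.toReal_mul] at h3
    rw [h2]
    have : (2 : ℝ≥0∞).toReal = 2 := by norm_num
    rw [this] at h3
    linarith
  · exact ne_top_of_le_ne_top (ENNReal.mul_ne_top (ENNReal.mul_ne_top (by norm_num) hC₁) hXfin) h1

end Global

end

end Literature.Analysis.UnboundedOperators
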